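import Mathlib
import Summits.KontsevichZagierPeriods.Zeta5Search.ABFamilyFPCasLB
import HarnessLib

/-!
# ζ(5) search — integer data of the A/B linear family `n·(3t+14; t+6,…,t)` in its first period: parameters, sortedness, `⌊d/p⌋`, the closed form of `N_p`

Cell `pub-zeta5` (HONEST FRAMING: systematic search; no irrationality claim unless certified), TRACK «DENOM-LAW» D1 prover seat
(denom-prover-d1 g16, `HOME/denom-law/prover-d1/ATTEMPT-16.md` §7).  Bookkeeping for the PATH-accounting assembly `DenomLaw/ABFamilyFPPath` on the
A/B linear family `bLin (t n) (t n + 2n) n = n·(3t+14; t+6, …, t)` (`b₀ = (3t+14)n`, `d = (2t+21)n`, pair blocks `(t+i+k)·n`, `1 ≤ i < k ≤ 7`):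
the parameter values with pushed casts, `Sorted7`, the shallow threshold `(t+13)n < p`, `⌊d/p⌋ ∈ {3, 2, 1}` by position, and
`pairFloors_ab` — `N_p = [p≤(t+3)n] + [p≤(t+4)n] + 2[p≤(t+5)n] + 2[p≤(t+6)n] + 3[p≤(t+7)n] + 3[p≤(t+8)n] + 3[p≤(t+9)n] + 2[p≤(t+10)n] + 2[p≤(t+11)n]
+ [p≤(t+12)n] + [p≤(t+13)n]` for every first-period prime — with its values `21, 20, 19, 17, 15, 12, 9, 6, 4, 2, 1` cell by cell.  Integer arithmetic
only; nothing about ζ(5); no γ; records in print UNMOVED.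
-/

open Finset

namespace Summit.KontsevichZagierPeriods.Zeta5Search.ABFamFP

open Summit.KontsevichZagierPeriods.Zeta5Search.CasoratianValuation (pairFloors)
open Summit.KontsevichZagierPeriods.Zeta5Search.WedgeDictionary (dOf)
open Summit.KontsevichZagierPeriods.Zeta5Search.CellKit
open Summit.KontsevichZagierPeriods.Zeta5Search.RuleRAB (ab_zero dOf_ab)
open Summit.KontsevichZagierPeriods.Zeta5Search.DenomLaw (Sorted7 BlockGe)

/-! ## §1 The integer data on the family -/

section Arith
variable {t n p : ℕ}

/-- `b₁ = (t+6)n`. -/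
theorem v1 (t n : ℕ) : bLin (t * n) (t * n + 2 * n) n 1 = (t : ℤ) * n + 6 * n := by
  show bLin (t * n) (t * n + 2 * n) n ((⟨0, by norm_num⟩ : Fin 7).val + 1) = _; rw [ab_param]; push_cast; ring
/-- `b₂ = (t+5)n`. -/
theorem v2 (t n : ℕ) : bLin (t * n) (t * n + 2 * n) n 2 = (t : ℤ) * n + 5 * n := by
  show bLin (t * n) (t * n + 2 * n) n ((⟨1, by norm_num⟩ : Fin 7).val + 1) = _; rw [ab_param]; push_cast; ring
/-- `b₃ = (t+4)n`. -/
theorem v3 (t n : ℕ) : bLin (t * n) (t * n + 2 * n) n 3 = (t : ℤ) * n + 4 * n := by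
  show bLin (t * n) (t * n + 2 * n) n ((⟨2, by norm_num⟩ : Fin 7).val + 1) = _; rw [ab_param]; push_cast; ring
/-- `b₄ = (t+3)n`. -/
theorem v4 (t n : ℕ) : bLin (t * n) (t * n + 2 * n) n 4 = (t : ℤ) * n + 3 * n := by
  show bLin (t * n) (t * n + 2 * n) n ((⟨3, by norm_num⟩ : Fin 7).val + 1) = _; rw [ab_param]; push_cast; ring
/-- `b₅ = (t+2)n`. -/
theorem v5 (t n : ℕ) : bLin (t * n) (t * n + 2 * n) n 5 = (t : ℤ) * n + 2 * n := by
  show bLin (t * n) (t * n + 2 * n) n ((⟨4, by norm_num⟩ : Fin 7).val + 1) = _; rw [ab_param]; push_cast; ring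
/-- `b₆ = (t+1)n`. -/
theorem v6 (t n : ℕ) : bLin (t * n) (t * n + 2 * n) n 6 = (t : ℤ) * n + 1 * n := by
  show bLin (t * n) (t * n + 2 * n) n ((⟨5, by norm_num⟩ : Fin 7).val + 1) = _; rw [ab_param]; push_cast; ring
/-- `b₇ = tn`. -/
theorem v7 (t n : ℕ) : bLin (t * n) (t * n + 2 * n) n 7 = (t : ℤ) * n := by
  show bLin (t * n) (t * n + 2 * n) n ((⟨6, by norm_num⟩ : Fin 7).val + 1) = _; rw [ab_param]; push_cast; ring
/-- `b₀ = (3t+14)n` (pushed casts). -/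
theorem v0 (t n : ℕ) : bLin (t * n) (t * n + 2 * n) n 0 = 3 * ((t : ℤ) * n) + 14 * n := by rw [ab_zero]; push_cast; ring

/-- The family is sorted: `b₁ ≥ b₂ ≥ … ≥ b₇`. -/
theorem sorted7_ab (t n : ℕ) : Sorted7 (bLin (t * n) (t * n + 2 * n) n) := by
  intro i hi
  simp only [Finset.mem_range] at hi
  have hn : (0 : ℤ) ≤ n := by positivity
  interval_cases i <;> simp only [Nat.reduceAdd, v1, v2, v3, v4, v5, v6, v7] <;> linarith

/-- Above `(t+13)n` no pair block reaches `p` (the largest block is `b₀ − b₆ − b₇ = (t+13)n`). -/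
theorem not_blockGe67_ab (h : t * n + 13 * n < p) : ¬ BlockGe (bLin (t * n) (t * n + 2 * n) n) p 6 7 := by
  unfold BlockGe; rw [v0, v6, v7]
  have h' : ((t * n + 13 * n : ℕ) : ℤ) < p := by exact_mod_cast h
  push_cast at h'
  linarith

/-- `⌊d/p⌋ ≤ 3` in the first period (`4p > (2t+26)n > d`). -/
theorem dOf_ab_div_le_three (hF : t * n + 13 * n < 2 * p) : dOf (bLin (t * n) (t * n + 2 * n) n) / (p : ℤ) ≤ 3 := by
  have hp0 : (0 : ℤ) < p := by exact_mod_cast (show 0 < p by omega)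
  have h1' : ((2 * (t * n) + 21 * n : ℕ) : ℤ) < 4 * p := by exact_mod_cast (show 2 * (t * n) + 21 * n < 4 * p by omega)
  rw [dOf_ab]
  have : (((2 * (t * n) + 21 * n : ℕ) : ℤ)) / (p : ℤ) < 4 := by rw [Int.ediv_lt_iff_lt_mul hp0]; linarith
  omega

/-- `2 ≤ ⌊d/p⌋` for `2p ≤ d`. -/
theorem dOf_ab_div_ge_two (h2 : 2 * p ≤ 2 * (t * n) + 21 * n) (hp : 0 < p) : 2 ≤ dOf (bLin (t * n) (t * n + 2 * n) n) / (p : ℤ) := by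
  have hp0 : (0 : ℤ) < p := by exact_mod_cast hp
  have h2' : (2 * p : ℤ) ≤ ((2 * (t * n) + 21 * n : ℕ) : ℤ) := by exact_mod_cast h2
  rw [dOf_ab, Int.le_ediv_iff_mul_le hp0]; linarith

/-- `⌊d/p⌋ = 2` for `(2t+21)n < 3p`, `2p ≤ (2t+21)n`. -/
theorem dOf_ab_div_two (h1 : 2 * (t * n) + 21 * n < 3 * p) (h2 : 2 * p ≤ 2 * (t * n) + 21 * n) :
    dOf (bLin (t * n) (t * n + 2 * n) n) / (p : ℤ) = 2 := by
  have hp0 : (0 : ℤ) < p := by exact_mod_cast (show 0 < p by omega)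
  have h1' : ((2 * (t * n) + 21 * n : ℕ) : ℤ) < 3 * p := by exact_mod_cast h1
  apply le_antisymm
  · rw [dOf_ab]
    have : (((2 * (t * n) + 21 * n : ℕ) : ℤ)) / (p : ℤ) < 3 := by rw [Int.ediv_lt_iff_lt_mul hp0]; linarith
    omega
  · exact dOf_ab_div_ge_two h2 (by omega)

/-- `⌊d/p⌋ = 1` for `(2t+21)n < 2p`, `p ≤ (2t+21)n`. -/
theorem dOf_ab_div_one (h1 : 2 * (t * n) + 21 * n < 2 * p) (h2 : p ≤ 2 * (t * n) + 21 * n) :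
    dOf (bLin (t * n) (t * n + 2 * n) n) / (p : ℤ) = 1 := by
  have hp0 : (0 : ℤ) < p := by exact_mod_cast (show 0 < p by omega)
  have h1' : ((2 * (t * n) + 21 * n : ℕ) : ℤ) < 2 * p := by exact_mod_cast h1
  have h2' : (p : ℤ) ≤ ((2 * (t * n) + 21 * n : ℕ) : ℤ) := by exact_mod_cast h2
  rw [dOf_ab]
  apply le_antisymm
  · have : (((2 * (t * n) + 21 * n : ℕ) : ℤ)) / (p : ℤ) < 2 := by rw [Int.ediv_lt_iff_lt_mul hp0]; linarith
    omega
  · rw [Int.le_ediv_iff_mul_le hp0]; linarith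

/-- `⌊d/p⌋ ≤ 1` for `(2t+21)n < 2p`. -/
theorem dOf_ab_div_le_one (h1 : 2 * (t * n) + 21 * n < 2 * p) : dOf (bLin (t * n) (t * n + 2 * n) n) / (p : ℤ) ≤ 1 := by
  have hp0 : (0 : ℤ) < p := by exact_mod_cast (show 0 < p by omega)
  have h1' : ((2 * (t * n) + 21 * n : ℕ) : ℤ) < 2 * p := by exact_mod_cast h1
  rw [dOf_ab]
  have : (((2 * (t * n) + 21 * n : ℕ) : ℤ)) / (p : ℤ) < 2 := by rw [Int.ediv_lt_iff_lt_mul hp0]; linarith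
  omega

/-- `0 ≤ ⌊d/p⌋`. -/
theorem dOf_ab_div_nonneg : 0 ≤ dOf (bLin (t * n) (t * n + 2 * n) n) / (p : ℤ) := by
  rw [dOf_ab]; exact Int.ediv_nonneg (by positivity) (by positivity)

/-- **`N_p` on the first-period family** (`2p > (t+13)n`; the 21 pair blocks are `(t+i+k)·n`, `1 ≤ i < k ≤ 7`, each `< 2p`):
`N_p = [p≤(t+3)n] + [p≤(t+4)n] + 2[p≤(t+5)n] + 2[p≤(t+6)n] + 3[p≤(t+7)n] + 3[p≤(t+8)n] + 3[p≤(t+9)n] + 2[p≤(t+10)n] + 2[p≤(t+11)n] + [p≤(t+12)n] + [p≤(t+13)n]`. -/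
theorem pairFloors_ab (hF : t * n + 13 * n < 2 * p) :
    pairFloors (bLin (t * n) (t * n + 2 * n) n) p =
      (if p ≤ t * n + 3 * n then 1 else 0) + (if p ≤ t * n + 4 * n then 1 else 0) + 2 * (if p ≤ t * n + 5 * n then 1 else 0) +
      2 * (if p ≤ t * n + 6 * n then 1 else 0) + 3 * (if p ≤ t * n + 7 * n then 1 else 0) + 3 * (if p ≤ t * n + 8 * n then 1 else 0) +
      3 * (if p ≤ t * n + 9 * n then 1 else 0) + 2 * (if p ≤ t * n + 10 * n then 1 else 0) + 2 * (if p ≤ t * n + 11 * n then 1 else 0) +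
      (if p ≤ t * n + 12 * n then 1 else 0) + (if p ≤ t * n + 13 * n then 1 else 0) := by
  have hp0 : (0 : ℤ) < p := by exact_mod_cast (show 0 < p by omega)
  have hval : ∀ c : ℕ, c ≤ 13 → ((t * n + c * n : ℕ) : ℤ) / (p : ℤ) = if p ≤ t * n + c * n then 1 else 0 := by
    intro c hc
    have h2' : ((t * n + c * n : ℕ) : ℤ) < 2 * p := by
      have : t * n + c * n ≤ t * n + 13 * n := by gcongr
      exact_mod_cast (show t * n + c * n < 2 * p by omega)
    split_ifs with hle
    · have hle' : (p : ℤ) ≤ ((t * n + c * n : ℕ) : ℤ) := by exact_mod_cast hle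
      rw [Int.ediv_eq_iff_of_pos hp0]; constructor <;> linarith
    · push Not at hle
      exact Int.ediv_eq_zero_of_lt (by positivity) (by exact_mod_cast hle)
  have hq1 : ∀ (a b : ℤ) (c : ℕ), (14 : ℤ) - a - b = c → c ≤ 13 →
      (3 * ((t : ℤ) * n) + 14 * n - ((t : ℤ) * n + a * n) - ((t : ℤ) * n + b * n)) / (p : ℤ) = if p ≤ t * n + c * n then 1 else 0 := by
    intro a b c h hc
    rw [show 3 * ((t : ℤ) * n) + 14 * n - ((t : ℤ) * n + a * n) - ((t : ℤ) * n + b * n) = ((t * n + c * n : ℕ) : ℤ) by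
      push_cast; rw [← h]; ring]
    exact hval c hc
  have hq7 : ∀ (a : ℤ) (c : ℕ), (14 : ℤ) - a = c → c ≤ 13 →
      (3 * ((t : ℤ) * n) + 14 * n - ((t : ℤ) * n + a * n) - ((t : ℤ) * n)) / (p : ℤ) = if p ≤ t * n + c * n then 1 else 0 := by
    intro a c h hc
    rw [show 3 * ((t : ℤ) * n) + 14 * n - ((t : ℤ) * n + a * n) - ((t : ℤ) * n) = ((t * n + c * n : ℕ) : ℤ) by
      push_cast; rw [← h]; ring]
    exact hval c hc
  suffices hR : ∀ R : ℤ,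
      (if p ≤ t * n + 3 * n then 1 else 0) + (if p ≤ t * n + 4 * n then 1 else 0) + 2 * (if p ≤ t * n + 5 * n then 1 else 0) +
      2 * (if p ≤ t * n + 6 * n then 1 else 0) + 3 * (if p ≤ t * n + 7 * n then 1 else 0) + 3 * (if p ≤ t * n + 8 * n then 1 else 0) +
      3 * (if p ≤ t * n + 9 * n then 1 else 0) + 2 * (if p ≤ t * n + 10 * n then 1 else 0) + 2 * (if p ≤ t * n + 11 * n then 1 else 0) +
      (if p ≤ t * n + 12 * n then 1 else 0) + (if p ≤ t * n + 13 * n then 1 else 0) = R →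
      pairFloors (bLin (t * n) (t * n + 2 * n) n) p = R from hR _ rfl
  intro R hR
  unfold pairFloors
  simp only [sum_range_succ, sum_range_zero, zero_add, Nat.reduceAdd, v0, v1, v2, v3, v4, v5, v6, v7, Nat.lt_irrefl, if_false,
    show (0:ℕ) < 1 by norm_num, show (0:ℕ) < 2 by norm_num, show (0:ℕ) < 3 by norm_num, show (0:ℕ) < 4 by norm_num, show (0:ℕ) < 5 by norm_num,
    show (0:ℕ) < 6 by norm_num, show (1:ℕ) < 2 by norm_num, show (1:ℕ) < 3 by norm_num, show (1:ℕ) < 4 by norm_num, show (1:ℕ) < 5 by norm_num,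
    show (1:ℕ) < 6 by norm_num, show (2:ℕ) < 3 by norm_num, show (2:ℕ) < 4 by norm_num, show (2:ℕ) < 5 by norm_num, show (2:ℕ) < 6 by norm_num,
    show (3:ℕ) < 4 by norm_num, show (3:ℕ) < 5 by norm_num, show (3:ℕ) < 6 by norm_num, show (4:ℕ) < 5 by norm_num, show (4:ℕ) < 6 by norm_num,
    show (5:ℕ) < 6 by norm_num, if_true,
    show ¬ (1:ℕ) < 0 by norm_num, show ¬ (2:ℕ) < 0 by norm_num, show ¬ (3:ℕ) < 0 by norm_num, show ¬ (4:ℕ) < 0 by norm_num, show ¬ (5:ℕ) < 0 by norm_num,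
    show ¬ (6:ℕ) < 0 by norm_num, show ¬ (2:ℕ) < 1 by norm_num, show ¬ (3:ℕ) < 1 by norm_num, show ¬ (4:ℕ) < 1 by norm_num, show ¬ (5:ℕ) < 1 by norm_num,
    show ¬ (6:ℕ) < 1 by norm_num, show ¬ (3:ℕ) < 2 by norm_num, show ¬ (4:ℕ) < 2 by norm_num, show ¬ (5:ℕ) < 2 by norm_num, show ¬ (6:ℕ) < 2 by norm_num,
    show ¬ (4:ℕ) < 3 by norm_num, show ¬ (5:ℕ) < 3 by norm_num, show ¬ (6:ℕ) < 3 by norm_num, show ¬ (5:ℕ) < 4 by norm_num, show ¬ (6:ℕ) < 4 by norm_num,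
    show ¬ (6:ℕ) < 5 by norm_num, add_zero]
  rw [hq1 6 5 3 (by norm_num) (by norm_num), hq1 6 4 4 (by norm_num) (by norm_num), hq1 6 3 5 (by norm_num) (by norm_num),
      hq1 6 2 6 (by norm_num) (by norm_num), hq1 6 1 7 (by norm_num) (by norm_num), hq7 6 8 (by norm_num) (by norm_num),
      hq1 5 4 5 (by norm_num) (by norm_num), hq1 5 3 6 (by norm_num) (by norm_num), hq1 5 2 7 (by norm_num) (by norm_num),
      hq1 5 1 8 (by norm_num) (by norm_num), hq7 5 9 (by norm_num) (by norm_num), hq1 4 3 7 (by norm_num) (by norm_num),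
      hq1 4 2 8 (by norm_num) (by norm_num), hq1 4 1 9 (by norm_num) (by norm_num), hq7 4 10 (by norm_num) (by norm_num),
      hq1 3 2 9 (by norm_num) (by norm_num), hq1 3 1 10 (by norm_num) (by norm_num), hq7 3 11 (by norm_num) (by norm_num),
      hq1 2 1 11 (by norm_num) (by norm_num), hq7 2 12 (by norm_num) (by norm_num), hq7 1 13 (by norm_num) (by norm_num), ← hR]
  ring

/-- `N_p = 21` for `p ≤ (t+3)n` (the deep cells and the top rule-R2 cell). -/
theorem N_le3 (hB : p ≤ t * n + 3 * n) (hF : t * n + 13 * n < 2 * p) : pairFloors (bLin (t * n) (t * n + 2 * n) n) p = 21 := by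
  rw [pairFloors_ab hF]; simp only [show p ≤ t * n + 3 * n from hB, show p ≤ t * n + 4 * n by omega, show p ≤ t * n + 5 * n by omega,
    show p ≤ t * n + 6 * n by omega, show p ≤ t * n + 7 * n by omega, show p ≤ t * n + 8 * n by omega, show p ≤ t * n + 9 * n by omega,
    show p ≤ t * n + 10 * n by omega, show p ≤ t * n + 11 * n by omega, show p ≤ t * n + 12 * n by omega, show p ≤ t * n + 13 * n by omega, if_true]; norm_num
/-- `N_p = 20` on `(t+3)n < p ≤ (t+4)n`. -/
theorem N_a3 (hA : t * n + 3 * n < p) (hB : p ≤ t * n + 4 * n) (hF : t * n + 13 * n < 2 * p) :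
    pairFloors (bLin (t * n) (t * n + 2 * n) n) p = 20 := by
  rw [pairFloors_ab hF]; simp only [show ¬ p ≤ t * n + 3 * n by omega, show p ≤ t * n + 4 * n from hB, show p ≤ t * n + 5 * n by omega, show p ≤ t * n + 6 * n by omega, show p ≤ t * n + 7 * n by omega, show p ≤ t * n + 8 * n by omega, show p ≤ t * n + 9 * n by omega, show p ≤ t * n + 10 * n by omega, show p ≤ t * n + 11 * n by omega, show p ≤ t * n + 12 * n by omega, show p ≤ t * n + 13 * n by omega, if_true, if_false]; norm_num
/-- `N_p = 19` on `(t+4)n < p ≤ (t+5)n`. -/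
theorem N_a4 (hA : t * n + 4 * n < p) (hB : p ≤ t * n + 5 * n) (hF : t * n + 13 * n < 2 * p) :
    pairFloors (bLin (t * n) (t * n + 2 * n) n) p = 19 := by
  rw [pairFloors_ab hF]; simp only [show ¬ p ≤ t * n + 3 * n by omega, show ¬ p ≤ t * n + 4 * n by omega, show p ≤ t * n + 5 * n from hB, show p ≤ t * n + 6 * n by omega, show p ≤ t * n + 7 * n by omega, show p ≤ t * n + 8 * n by omega, show p ≤ t * n + 9 * n by omega, show p ≤ t * n + 10 * n by omega, show p ≤ t * n + 11 * n by omega, show p ≤ t * n + 12 * n by omega, show p ≤ t * n + 13 * n by omega, if_true, if_false]; norm_num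
/-- `N_p = 17` on `(t+5)n < p ≤ (t+6)n`. -/
theorem N_a5 (hA : t * n + 5 * n < p) (hB : p ≤ t * n + 6 * n) (hF : t * n + 13 * n < 2 * p) :
    pairFloors (bLin (t * n) (t * n + 2 * n) n) p = 17 := by
  rw [pairFloors_ab hF]; simp only [show ¬ p ≤ t * n + 3 * n by omega, show ¬ p ≤ t * n + 4 * n by omega, show ¬ p ≤ t * n + 5 * n by omega, show p ≤ t * n + 6 * n from hB, show p ≤ t * n + 7 * n by omega, show p ≤ t * n + 8 * n by omega, show p ≤ t * n + 9 * n by omega, show p ≤ t * n + 10 * n by omega, show p ≤ t * n + 11 * n by omega, show p ≤ t * n + 12 * n by omega, show p ≤ t * n + 13 * n by omega, if_true, if_false]; norm_num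
/-- `N_p = 15` on `(t+6)n < p ≤ (t+7)n`. -/
theorem N_a6 (hA : t * n + 6 * n < p) (hB : p ≤ t * n + 7 * n) (hF : t * n + 13 * n < 2 * p) :
    pairFloors (bLin (t * n) (t * n + 2 * n) n) p = 15 := by
  rw [pairFloors_ab hF]; simp only [show ¬ p ≤ t * n + 3 * n by omega, show ¬ p ≤ t * n + 4 * n by omega, show ¬ p ≤ t * n + 5 * n by omega, show ¬ p ≤ t * n + 6 * n by omega, show p ≤ t * n + 7 * n from hB, show p ≤ t * n + 8 * n by omega, show p ≤ t * n + 9 * n by omega, show p ≤ t * n + 10 * n by omega, show p ≤ t * n + 11 * n by omega, show p ≤ t * n + 12 * n by omega, show p ≤ t * n + 13 * n by omega, if_true, if_false]; norm_num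
/-- `N_p = 12` on `(t+7)n < p ≤ (t+8)n`. -/
theorem N_a7 (hA : t * n + 7 * n < p) (hB : p ≤ t * n + 8 * n) (hF : t * n + 13 * n < 2 * p) :
    pairFloors (bLin (t * n) (t * n + 2 * n) n) p = 12 := by
  rw [pairFloors_ab hF]; simp only [show ¬ p ≤ t * n + 3 * n by omega, show ¬ p ≤ t * n + 4 * n by omega, show ¬ p ≤ t * n + 5 * n by omega, show ¬ p ≤ t * n + 6 * n by omega, show ¬ p ≤ t * n + 7 * n by omega, show p ≤ t * n + 8 * n from hB, show p ≤ t * n + 9 * n by omega, show p ≤ t * n + 10 * n by omega, show p ≤ t * n + 11 * n by omega, show p ≤ t * n + 12 * n by omega, show p ≤ t * n + 13 * n by omega, if_true, if_false]; norm_num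
/-- `N_p = 9` on `(t+8)n < p ≤ (t+9)n`. -/
theorem N_a8 (hA : t * n + 8 * n < p) (hB : p ≤ t * n + 9 * n) (hF : t * n + 13 * n < 2 * p) :
    pairFloors (bLin (t * n) (t * n + 2 * n) n) p = 9 := by
  rw [pairFloors_ab hF]; simp only [show ¬ p ≤ t * n + 3 * n by omega, show ¬ p ≤ t * n + 4 * n by omega, show ¬ p ≤ t * n + 5 * n by omega, show ¬ p ≤ t * n + 6 * n by omega, show ¬ p ≤ t * n + 7 * n by omega, show ¬ p ≤ t * n + 8 * n by omega, show p ≤ t * n + 9 * n from hB, show p ≤ t * n + 10 * n by omega, show p ≤ t * n + 11 * n by omega, show p ≤ t * n + 12 * n by omega, show p ≤ t * n + 13 * n by omega, if_true, if_false]; norm_num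
/-- `N_p = 6` on `(t+9)n < p ≤ (t+10)n`. -/
theorem N_a9 (hA : t * n + 9 * n < p) (hB : p ≤ t * n + 10 * n) (hF : t * n + 13 * n < 2 * p) :
    pairFloors (bLin (t * n) (t * n + 2 * n) n) p = 6 := by
  rw [pairFloors_ab hF]; simp only [show ¬ p ≤ t * n + 3 * n by omega, show ¬ p ≤ t * n + 4 * n by omega, show ¬ p ≤ t * n + 5 * n by omega, show ¬ p ≤ t * n + 6 * n by omega, show ¬ p ≤ t * n + 7 * n by omega, show ¬ p ≤ t * n + 8 * n by omega, show ¬ p ≤ t * n + 9 * n by omega, show p ≤ t * n + 10 * n from hB, show p ≤ t * n + 11 * n by omega, show p ≤ t * n + 12 * n by omega, show p ≤ t * n + 13 * n by omega, if_true, if_false]; norm_num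
/-- `N_p = 4` on `(t+10)n < p ≤ (t+11)n`. -/
theorem N_a10 (hA : t * n + 10 * n < p) (hB : p ≤ t * n + 11 * n) (hF : t * n + 13 * n < 2 * p) :
    pairFloors (bLin (t * n) (t * n + 2 * n) n) p = 4 := by
  rw [pairFloors_ab hF]; simp only [show ¬ p ≤ t * n + 3 * n by omega, show ¬ p ≤ t * n + 4 * n by omega, show ¬ p ≤ t * n + 5 * n by omega, show ¬ p ≤ t * n + 6 * n by omega, show ¬ p ≤ t * n + 7 * n by omega, show ¬ p ≤ t * n + 8 * n by omega, show ¬ p ≤ t * n + 9 * n by omega, show ¬ p ≤ t * n + 10 * n by omega, show p ≤ t * n + 11 * n from hB, show p ≤ t * n + 12 * n by omega, show p ≤ t * n + 13 * n by omega, if_true, if_false]; norm_num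
/-- `N_p = 2` on `(t+11)n < p ≤ (t+12)n`. -/
theorem N_a11 (hA : t * n + 11 * n < p) (hB : p ≤ t * n + 12 * n) (hF : t * n + 13 * n < 2 * p) :
    pairFloors (bLin (t * n) (t * n + 2 * n) n) p = 2 := by
  rw [pairFloors_ab hF]; simp only [show ¬ p ≤ t * n + 3 * n by omega, show ¬ p ≤ t * n + 4 * n by omega, show ¬ p ≤ t * n + 5 * n by omega, show ¬ p ≤ t * n + 6 * n by omega, show ¬ p ≤ t * n + 7 * n by omega, show ¬ p ≤ t * n + 8 * n by omega, show ¬ p ≤ t * n + 9 * n by omega, show ¬ p ≤ t * n + 10 * n by omega, show ¬ p ≤ t * n + 11 * n by omega, show p ≤ t * n + 12 * n from hB, show p ≤ t * n + 13 * n by omega, if_true, if_false]; norm_num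
/-- `N_p = 1` on `(t+12)n < p ≤ (t+13)n`. -/
theorem N_a12 (hA : t * n + 12 * n < p) (hB : p ≤ t * n + 13 * n) (hF : t * n + 13 * n < 2 * p) :
    pairFloors (bLin (t * n) (t * n + 2 * n) n) p = 1 := by
  rw [pairFloors_ab hF]; simp only [show ¬ p ≤ t * n + 3 * n by omega, show ¬ p ≤ t * n + 4 * n by omega, show ¬ p ≤ t * n + 5 * n by omega, show ¬ p ≤ t * n + 6 * n by omega, show ¬ p ≤ t * n + 7 * n by omega, show ¬ p ≤ t * n + 8 * n by omega, show ¬ p ≤ t * n + 9 * n by omega, show ¬ p ≤ t * n + 10 * n by omega, show ¬ p ≤ t * n + 11 * n by omega, show ¬ p ≤ t * n + 12 * n by omega, show p ≤ t * n + 13 * n from hB, if_true, if_false]; norm_num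

end Arith

end Summit.KontsevichZagierPeriods.Zeta5Search.ABFamFP
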